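import Literature.Analysis.SegalBargmann.FockBargmann

/-!
# The Bargmann transform IS Folland's integral transform (Folland 1989, §1.6), on all of `L²(ℝ^σ)`

Source followed: G. B. Folland, *Harmonic Analysis in Phase Space*, Ch. 1 §6, cited by item.

Folland §1.6 (the definition preceding Theorem (1.63)): "For `z ∈ ℂⁿ` let us define
`Bf(z) = 2^{n/4} ∫ f(x) e^{2πxz − πx² − (π/2)z²} dx`."  "`V(f, φ_0)(p, q) = e^{−(π/2)|z|²} Bf(z)`, with `z = p + iq`."
"`Bf` is called the Bargmann transform of `f`. ... `B` is an isometry from `L²(ℝⁿ)` into `L²(ℂⁿ, e^{−π|z|²}dz)`."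
After (1.72): `B(L²(ℝⁿ)) = 𝓕_n`; (1.73)/(1.75), §1.7: `B Z_j^* = π^{1/2} A_j^* B = z_j B` (multiplication by `z_j`).

What is proved here (no cited facts). `bargmann : Lp ℂ 2 (volume : Measure (σ → ℝ)) ≃ₗᵢ[ℂ] FockL2 σ` is the
unitary of `FockBargmann` (defined by matching the Hermite and Fock Hilbert bases, `B h_α = ζ_α`). This file proves
that it is given, for EVERY `f ∈ L²(ℝ^σ)`, by Folland's integral:
* `bargmannFun f z := 2^{n/4} · e^{−(π/2) Σ z_k²} · ∫ f(x) e^{Σ(2π z_k x_k − π x_k²)} dx` (the factor `e^{−(π/2)z²}` of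
  the printed kernel is constant in `x` and written in front; `bargmannFun_eq_integral` is the printed form verbatim);
* `bargmann_coeFn f : ⇑(bargmann f) =ᵐ[volume] fun z => e^{−(π/2)|z|²} · bargmannFun f z` — i.e. the `L²(ℂ^σ, dz)`
  avatar of `Bf` (the transport `F ↦ e^{−(π/2)|z|²}F`, cf. `FockSpaceL2`) is a.e. Folland's integral.
Route (all proved below): (i) 1-dim moments `∫ t^m e^{−2πt² + ct} dt`, `c ∈ ℂ`, by integration by parts and
Mathlib's `integral_cexp_quadratic`; (ii) on `ℝ^σ`, `∫ (∂_j r − 4πx_j r + 2πz_j r) e^{−2π|x|²+2πz·x} dx = 0`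
(`gintz_div`), whence `B(Z_j^* g) = z_j · Bg` on the core `{p(x)e^{−π|x|²}}` (`bargmannFun_opZs`); (iii) the
Gaussian `B h_0 = 1` (`bargmannFun_vac`, constants `2^{n/4}·2^{n/4}·2^{−n/2} = 1`); (iv) induction over the
polynomial ring: `B(F(Z^*)h_0)(z) = F(z)` for every polynomial `F` (`bargmannFun_binv`), which with
`bargmann_hermToL2_binv` of `FockBargmann` identifies the two transforms on the dense core
(`bargmann_hermToL2_coeFn`); (v) extension to all `f`: for fixed `z`, `f ↦ Bf(z) = ⟨K_z, f⟩` is continuous on `L²`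
(the kernel `x ↦ e^{2πx·z−π|x|²}` is in `L²_x`, `memLp_bkerCore`), `bargmann` is continuous into `L²(ℂ^σ)`, and an
`L²`-convergent sequence has an a.e.-convergent subsequence (`tendstoInMeasure_of_tendsto_Lp`,
`TendstoInMeasure.exists_seq_tendsto_ae`).

## What is NOT in this file

The RANGE statement `FockL2 σ = e^{−(π/2)|z|²}·𝓕_n` with `𝓕_n` the entire functions of (1.63) (several-variable
Taylor expansions and the pointwise bound (1.67)) — see `FockBargmannEntire`, `FockReproducingKernel`,
`FockCompleteness`.

## References

* [Folland1989] G. B. Folland, *Harmonic Analysis in Phase Space*, Annals of Mathematics Studies 122, Princeton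
  University Press, 1989, Ch. 1 §1.6 (doi:10.1515/9781400882427).
* V. Bargmann, *On a Hilbert space of analytic functions and an associated integral transform, Part I*,
  Comm. Pure Appl. Math. 14 (1961) 187–214, §2 (the integral transform `A`).

Filed under the LEAN-IN-TREE rule (2026-08-18) by seat pv05-g8 from the HodgeCM/PerL working package file
`HodgeCM/PerL34/FockBargmannKernel.lean` (origin seat pv05-g5/g6); statements and proofs unchanged, namespace
`HodgeCM.PerL34.Fock.Hermite` ↦ `Literature.Analysis.SegalBargmann`.
-/

set_option autoImplicit false

open MvPolynomial Complex MeasureTheory Filter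
open scoped Real InnerProductSpace Topology

namespace Literature.Analysis.SegalBargmann

noncomputable section

/-! ### One real variable with a complex linear term: the moments `J_c(m) = ∫ t^m e^{−2πt² + ct} dt` -/

/-- `gmz c m t = t^m e^{−2πt² + ct}` (`c ∈ ℂ`). [folklore] -/
def gmz (c : ℂ) (m : ℕ) (t : ℝ) : ℂ := (t : ℂ) ^ m * cexp (-(2 * π : ℂ) * (t : ℂ) ^ 2 + c * t)

/-- `t ↦ t^m e^{−2πt² + ct}` is continuous. [folklore] -/
theorem continuous_gmz (c : ℂ) (m : ℕ) : Continuous (gmz c m) := by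
  unfold gmz
  fun_prop

/-- Real part of the exponent: `Re(−2πt² + ct) = −2πt² + (Re c) t`. [folklore] -/
theorem re_quad (c : ℂ) (t : ℝ) : (-(2 * π : ℂ) * (t : ℂ) ^ 2 + c * t).re = -(2 * π) * t ^ 2 + c.re * t := by
  simp [Complex.add_re, Complex.mul_re, Complex.neg_re, Complex.ofReal_re, Complex.ofReal_im, pow_two]

/-- `|t^m e^{−2πt² + ct}| = |t|^m e^{−2πt² + (Re c) t}`. [folklore] -/
theorem norm_gmz (c : ℂ) (m : ℕ) (t : ℝ) : ‖gmz c m t‖ = |t| ^ m * Real.exp (-(2 * π) * t ^ 2 + c.re * t) := by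
  rw [gmz, norm_mul, norm_pow, Complex.norm_real, Real.norm_eq_abs, Complex.norm_exp, re_quad]

/-- Completing the square: `−2πt² + at ≤ a²/(4π) − πt²`. [folklore] -/
theorem quad_le (a t : ℝ) : -(2 * π) * t ^ 2 + a * t ≤ a ^ 2 / (4 * π) + -π * t ^ 2 := by
  have hπ : 0 < π := Real.pi_pos
  have key : a ^ 2 / (4 * π) + -π * t ^ 2 - (-(2 * π) * t ^ 2 + a * t) = (2 * π * t - a) ^ 2 / (4 * π) := by
    field_simp
    ring
  rw [← sub_nonneg, key]
  positivity

/-- Gaussian domination of the moments with a linear term: `|t^m e^{−2πt²+ct}| ≤ e^{(Re c)²/(4π)} ·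
|t|^m e^{−πt²}` (completing the square). [folklore] -/
theorem norm_gmz_le (c : ℂ) (m : ℕ) (t : ℝ) :
    ‖gmz c m t‖ ≤ Real.exp (c.re ^ 2 / (4 * π)) * ‖t ^ (m : ℝ) * Real.exp (-π * t ^ 2)‖ := by
  rw [norm_gmz, norm_mul, Real.norm_eq_abs, Real.norm_eq_abs, Real.rpow_natCast, abs_pow,
    abs_of_pos (Real.exp_pos _), ← mul_assoc, mul_comm (Real.exp _) (|t| ^ m), mul_assoc, ← Real.exp_add]
  exact mul_le_mul_of_nonneg_left (Real.exp_le_exp.mpr (quad_le c.re t)) (pow_nonneg (abs_nonneg t) m)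

/-- Each moment `t ↦ t^m e^{−2πt² + ct}` (`c ∈ ℂ`) is integrable on `ℝ`. [folklore] -/
theorem integrable_gmz (c : ℂ) (m : ℕ) : Integrable (gmz c m) := by
  have h := (integrable_rpow_mul_exp_neg_mul_sq (b := π) Real.pi_pos (s := (m : ℝ))
    (by have : (0 : ℝ) ≤ m := Nat.cast_nonneg m; linarith)).norm.const_mul (Real.exp (c.re ^ 2 / (4 * π)))
  exact h.mono' (continuous_gmz c m).aestronglyMeasurable (Eventually.of_forall (norm_gmz_le c m))

/-- `(e^{−2πs² + cs})' = (−4πt + c) e^{−2πt² + ct}` at `s = t`. [folklore] -/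
theorem hasDerivAt_cexp_quad (c : ℂ) (t : ℝ) :
    HasDerivAt (fun s : ℝ => cexp (-(2 * π : ℂ) * (s : ℂ) ^ 2 + c * s))
      ((-(4 * π : ℂ) * (t : ℂ) + c) * cexp (-(2 * π : ℂ) * (t : ℂ) ^ 2 + c * t)) t := by
  have h1 : HasDerivAt (fun s : ℂ => -(2 * π : ℂ) * s ^ 2 + c * s) (-(2 * π : ℂ) * (2 * (t : ℂ)) + c) (t : ℂ) := by
    have ha : HasDerivAt (fun y : ℂ => -(2 * π : ℂ) * y ^ 2) (-(2 * π : ℂ) * (2 * (t : ℂ))) (t : ℂ) := by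
      have := (hasDerivAt_pow 2 (t : ℂ)).const_mul (-(2 * π : ℂ))
      simpa using this
    have hb : HasDerivAt (fun y : ℂ => c * y) c (t : ℂ) := by
      have := (hasDerivAt_id (t : ℂ)).const_mul c
      simpa using this
    exact ha.add hb
  have h2 := (h1.cexp).comp_ofReal
  refine h2.congr_deriv ?_
  ring

/-- `(t^{m+1} e^{q})' = (m+1) t^m e^q − 4π t^{m+2} e^q + c t^{m+1} e^q`, `q = −2πt² + ct`.
[folklore] -/
theorem hasDerivAt_gmz_succ (c : ℂ) (m : ℕ) (t : ℝ) :
    HasDerivAt (gmz c (m + 1))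
      (((m : ℂ) + 1) * gmz c m t - (4 * π : ℂ) * gmz c (m + 2) t + c * gmz c (m + 1) t) t := by
  have h1 : HasDerivAt (fun s : ℝ => (s : ℂ) ^ (m + 1)) (((m : ℂ) + 1) * (t : ℂ) ^ m) t := by
    have := (hasDerivAt_pow (m + 1) (t : ℂ)).comp_ofReal
    refine this.congr_deriv ?_
    push_cast
    ring
  have h := h1.mul (hasDerivAt_cexp_quad c t)
  refine h.congr_deriv ?_
  simp only [gmz]
  ring

/-- Derivative of the zeroth moment function: `(gmz c 0)' = −4π · gmz c 1 + c · gmz c 0`.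
[folklore] -/
theorem hasDerivAt_gmz_zero (c : ℂ) (t : ℝ) :
    HasDerivAt (gmz c 0) (-(4 * π : ℂ) * gmz c 1 t + c * gmz c 0 t) t := by
  have h := hasDerivAt_cexp_quad c t
  have hfun : gmz c 0 = fun s : ℝ => cexp (-(2 * π : ℂ) * (s : ℂ) ^ 2 + c * s) := by
    funext s; simp [gmz]
  rw [hfun]
  refine h.congr_deriv ?_
  simp only [gmz, pow_one]
  ring

/-- Integration by parts for the moments: `(m+1) J_c(m) − 4π J_c(m+2) + c J_c(m+1) = 0`, `J_c(m) =
∫ t^m e^{−2πt²+ct} dt`. [folklore] -/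
theorem integral_gmz_succ_succ (c : ℂ) (m : ℕ) :
    ((m : ℂ) + 1) * (∫ t, gmz c m t) - (4 * π : ℂ) * (∫ t, gmz c (m + 2) t) + c * ∫ t, gmz c (m + 1) t = 0 := by
  have hA : Integrable (fun t => ((m : ℂ) + 1) * gmz c m t) := (integrable_gmz c m).const_mul _
  have hB : Integrable (fun t => (4 * π : ℂ) * gmz c (m + 2) t) := (integrable_gmz c (m + 2)).const_mul _
  have hC : Integrable (fun t => c * gmz c (m + 1) t) := (integrable_gmz c (m + 1)).const_mul _
  have hAB : Integrable (fun t => ((m : ℂ) + 1) * gmz c m t - (4 * π : ℂ) * gmz c (m + 2) t) := hA.sub hB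
  have hint : Integrable (fun t => ((m : ℂ) + 1) * gmz c m t - (4 * π : ℂ) * gmz c (m + 2) t + c * gmz c (m + 1) t) :=
    hAB.add hC
  have h := integral_eq_zero_of_hasDerivAt_of_integrable (hasDerivAt_gmz_succ c m) hint (integrable_gmz c (m + 1))
  rw [integral_add hAB hC, integral_sub hA hB, integral_const_mul, integral_const_mul, integral_const_mul] at h
  exact h

/-- Integration by parts, lowest case: `−4π J_c(1) + c J_c(0) = 0`. [folklore] -/
theorem integral_gmz_one (c : ℂ) : -(4 * π : ℂ) * (∫ t, gmz c 1 t) + c * ∫ t, gmz c 0 t = 0 := by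
  have hA : Integrable (fun t => -(4 * π : ℂ) * gmz c 1 t) := (integrable_gmz c 1).const_mul _
  have hB : Integrable (fun t => c * gmz c 0 t) := (integrable_gmz c 0).const_mul _
  have hint : Integrable (fun t => -(4 * π : ℂ) * gmz c 1 t + c * gmz c 0 t) := hA.add hB
  have h := integral_eq_zero_of_hasDerivAt_of_integrable (hasDerivAt_gmz_zero c) hint (integrable_gmz c 0)
  rw [integral_add hA hB, integral_const_mul, integral_const_mul] at h
  exact h

/-- The divergence identity for the moments, uniformly in `b ≥ 0`:
`b J(b−1) − 4π J(b+1) + c J(b) = 0`. [folklore] -/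
theorem integral_gmz_div (c : ℂ) (b : ℕ) :
    (b : ℂ) * (∫ t, gmz c (b - 1) t) - (4 * π : ℂ) * (∫ t, gmz c (b + 1) t) + c * ∫ t, gmz c b t = 0 := by
  cases b with
  | zero =>
      have h := integral_gmz_one c
      simp only [Nat.cast_zero, zero_mul, zero_sub, zero_add]
      linear_combination h
  | succ m =>
      rw [Nat.succ_sub_one]
      push_cast
      exact integral_gmz_succ_succ c m

/-- The Gaussian integral with a complex linear term: `∫ e^{−2πt² + ct} dt = 2^{−1/2} e^{c²/(8π)}` (Mathlib).
[folklore] -/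
theorem integral_gmz_zero (c : ℂ) : ∫ t, gmz c 0 t = ((Real.sqrt 2)⁻¹ : ℝ) * cexp (c ^ 2 / (8 * π)) := by
  have hfun : gmz c 0 = fun t : ℝ => cexp (-(2 * π : ℂ) * (t : ℂ) ^ 2 + c * t + 0) := by
    funext t; simp [gmz]
  have hb : (-(2 * π : ℂ)).re < 0 := by
    simp only [Complex.neg_re, Complex.mul_re, Complex.re_ofNat, Complex.ofReal_re, Complex.im_ofNat,
      Complex.ofReal_im, mul_zero, sub_zero, Left.neg_neg_iff]
    positivity
  rw [hfun, integral_cexp_quadratic hb c 0]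
  have hπ : (π : ℂ) ≠ 0 := (Complex.ofReal_ne_zero.mpr Real.pi_ne_zero)
  have h1 : (π : ℂ) / -(-(2 * π : ℂ)) = ((2⁻¹ : ℝ) : ℂ) := by
    push_cast
    field_simp
  have h2 : (1 / 2 : ℂ) = ((2⁻¹ : ℝ) : ℂ) := by push_cast; ring
  have h3 : ((2 : ℝ)⁻¹) ^ ((2 : ℝ)⁻¹) = (Real.sqrt 2)⁻¹ := by
    rw [Real.sqrt_eq_rpow, one_div, Real.inv_rpow (by norm_num)]
  rw [h1, h2, ← Complex.ofReal_cpow (by norm_num), h3]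
  congr 1
  rw [zero_sub, show c ^ 2 / (4 * -(2 * π : ℂ)) = -(c ^ 2 / (8 * π)) by ring, neg_neg]

/-! ### `ℝ^σ`: the weight `e^{−2π|x|² + 2π z·x}` and the functional `r ↦ ∫ r(x) e^{−2π|x|²+2πz·x} dx` -/

section NDim

variable {σ : Type*} [Fintype σ] [DecidableEq σ]

omit [DecidableEq σ] in
/-- `e^{−2π|x|² + 2π z·x}` (`z ∈ ℂ^σ`, `x ∈ ℝ^σ`). [folklore] -/
def bweight (z : σ → ℂ) (x : σ → ℝ) : ℂ := cexp (∑ k, (-(2 * π : ℂ) * (x k : ℂ) ^ 2 + (2 * π : ℂ) * z k * (x k : ℂ)))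

omit [DecidableEq σ] in
/-- The weight `e^{Σ_k (−2πx_k² + 2π z_k x_k)}` factors over the coordinates. [folklore] -/
theorem bweight_eq_prod (z : σ → ℂ) (x : σ → ℝ) :
    bweight z x = ∏ k, cexp (-(2 * π : ℂ) * (x k : ℂ) ^ 2 + (2 * π : ℂ) * z k * (x k : ℂ)) := by
  rw [bweight, Complex.exp_sum]

omit [DecidableEq σ] in
/-- A monomial times the weight is the product of one-variable moment functions `gmz (2π z_k)
(β_k)`. [folklore] -/
theorem eval_monomial_mul_bweight (β : σ →₀ ℕ) (z : σ → ℂ) (x : σ → ℝ) :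
    eval (fun k => (x k : ℂ)) (monomial β (1 : ℂ)) * bweight z x = ∏ k, gmz ((2 * π : ℂ) * z k) (β k) (x k) := by
  rw [eval_monomial, one_mul, Finsupp.prod_fintype _ _ (fun i => pow_zero _), bweight_eq_prod, ← Finset.prod_mul_distrib]
  rfl

omit [DecidableEq σ] in
/-- Every monomial times `e^{−2π|x|² + 2π z·x}` is integrable on `ℝ^σ`. [folklore] -/
theorem integrable_monomial_bweight (β : σ →₀ ℕ) (z : σ → ℂ) :
    Integrable (fun x : σ → ℝ => eval (fun k => (x k : ℂ)) (monomial β (1 : ℂ)) * bweight z x) := by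
  have hfun : (fun x : σ → ℝ => eval (fun k => (x k : ℂ)) (monomial β (1 : ℂ)) * bweight z x) =
      fun x : σ → ℝ => ∏ k, gmz ((2 * π : ℂ) * z k) (β k) (x k) := by
    funext x; exact eval_monomial_mul_bweight β z x
  rw [hfun]
  exact Integrable.fintype_prod (fun k => integrable_gmz _ (β k))

omit [DecidableEq σ] in
/-- Every polynomial times `e^{−2π|x|² + 2π z·x}` is integrable on `ℝ^σ`. [folklore] -/
theorem integrable_eval_bweight (z : σ → ℂ) (p : MvPolynomial σ ℂ) :
    Integrable (fun x : σ → ℝ => eval (fun k => (x k : ℂ)) p * bweight z x) := by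
  induction p using MvPolynomial.induction_on' with
  | monomial β a =>
      have hfun : (fun x : σ → ℝ => eval (fun k => (x k : ℂ)) (monomial β a) * bweight z x) =
          fun x : σ → ℝ => a * (eval (fun k => (x k : ℂ)) (monomial β (1 : ℂ)) * bweight z x) := by
        funext x
        rw [monomial_eq_smul β a, smul_eval, mul_assoc]
      rw [hfun]
      exact (integrable_monomial_bweight β z).const_mul a
  | add p q hp hq =>
      have hfun : (fun x : σ → ℝ => eval (fun k => (x k : ℂ)) (p + q) * bweight z x) =
          fun x : σ → ℝ => eval (fun k => (x k : ℂ)) p * bweight z x + eval (fun k => (x k : ℂ)) q * bweight z x := by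
        funext x; rw [map_add, add_mul]
      rw [hfun]
      exact hp.add hq

omit [DecidableEq σ] in
/-- `gintz z r = ∫_{ℝ^σ} r(x) e^{−2π|x|² + 2πz·x} dx`, linear in the symbol `r`. [folklore] -/
def gintz (z : σ → ℂ) : MvPolynomial σ ℂ →ₗ[ℂ] ℂ where
  toFun r := ∫ x : σ → ℝ, eval (fun k => (x k : ℂ)) r * bweight z x
  map_add' p q := by
    simp only [map_add, add_mul]
    exact integral_add (integrable_eval_bweight z p) (integrable_eval_bweight z q)
  map_smul' c p := by
    simp only [smul_eval, smul_eq_mul, mul_assoc, RingHom.id_apply]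
    exact integral_const_mul c _

omit [DecidableEq σ] in
/-- Unfolding of the functional: `gintz z r = ∫ r(x) e^{−2π|x|² + 2π z·x} dx`. [folklore] -/
theorem gintz_apply (z : σ → ℂ) (r : MvPolynomial σ ℂ) :
    gintz z r = ∫ x : σ → ℝ, eval (fun k => (x k : ℂ)) r * bweight z x := rfl

omit [DecidableEq σ] in
/-- Fubini: `gintz z (x^β) = Π_k ∫ t^{β_k} e^{−2πt² + 2π z_k t} dt`. [folklore] -/
theorem gintz_monomial (z : σ → ℂ) (β : σ →₀ ℕ) :
    gintz z (monomial β (1 : ℂ)) = ∏ k, ∫ t, gmz ((2 * π : ℂ) * z k) (β k) t := by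
  rw [gintz_apply]
  simp_rw [eval_monomial_mul_bweight]
  exact integral_fintype_prod_volume_eq_prod (fun k => gmz ((2 * π : ℂ) * z k) (β k))

/-- **Integration by parts in `ℝ^σ` against `e^{−2π|x|²+2πz·x}`, monomial case**:
`∫ (∂_j − 4πx_j + 2πz_j)(x^β) e^{−2π|x|²+2πz·x} dx = 0`. [folklore] -/
theorem gintz_div_monomial (z : σ → ℂ) (j : σ) (β : σ →₀ ℕ) :
    gintz z (pderiv j (monomial β (1 : ℂ)) - (4 * π : ℂ) • (X j * monomial β 1) + ((2 * π : ℂ) * z j) • monomial β 1) = 0 := by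
  rw [pderiv_monomial, one_mul, X_mul_monomial_one, monomial_eq_smul (β - Finsupp.single j 1), map_add, map_sub,
    map_smul, map_smul, map_smul, gintz_monomial, gintz_monomial, gintz_monomial]
  set c : ℂ := (2 * π : ℂ) * z j with hc
  have e1 : ∏ k, (∫ t, gmz ((2 * π : ℂ) * z k) ((β - Finsupp.single j 1 : σ →₀ ℕ) k) t) =
      (∫ t, gmz c ((β - Finsupp.single j 1 : σ →₀ ℕ) j) t) *
        ∏ k ∈ Finset.univ.erase j, ∫ t, gmz ((2 * π : ℂ) * z k) ((β - Finsupp.single j 1 : σ →₀ ℕ) k) t :=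
    (Finset.mul_prod_erase _ _ (Finset.mem_univ j)).symm
  have e2 : ∏ k, (∫ t, gmz ((2 * π : ℂ) * z k) ((β + Finsupp.single j 1 : σ →₀ ℕ) k) t) =
      (∫ t, gmz c ((β + Finsupp.single j 1 : σ →₀ ℕ) j) t) *
        ∏ k ∈ Finset.univ.erase j, ∫ t, gmz ((2 * π : ℂ) * z k) ((β + Finsupp.single j 1 : σ →₀ ℕ) k) t :=
    (Finset.mul_prod_erase _ _ (Finset.mem_univ j)).symm
  have e3 : ∏ k, (∫ t, gmz ((2 * π : ℂ) * z k) (β k) t) =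
      (∫ t, gmz c (β j) t) * ∏ k ∈ Finset.univ.erase j, ∫ t, gmz ((2 * π : ℂ) * z k) (β k) t :=
    (Finset.mul_prod_erase _ _ (Finset.mem_univ j)).symm
  rw [e1, e2, e3]
  have h1 : ∏ k ∈ Finset.univ.erase j, (∫ t, gmz ((2 * π : ℂ) * z k) ((β - Finsupp.single j 1 : σ →₀ ℕ) k) t) =
      ∏ k ∈ Finset.univ.erase j, ∫ t, gmz ((2 * π : ℂ) * z k) (β k) t :=
    Finset.prod_congr rfl fun k hk => by
      rw [Finsupp.tsub_apply, Finsupp.single_apply, if_neg (Finset.ne_of_mem_erase hk).symm, tsub_zero]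
  have h2 : ∏ k ∈ Finset.univ.erase j, (∫ t, gmz ((2 * π : ℂ) * z k) ((β + Finsupp.single j 1 : σ →₀ ℕ) k) t) =
      ∏ k ∈ Finset.univ.erase j, ∫ t, gmz ((2 * π : ℂ) * z k) (β k) t :=
    Finset.prod_congr rfl fun k hk => by
      rw [Finsupp.add_apply, Finsupp.single_apply, if_neg (Finset.ne_of_mem_erase hk).symm, add_zero]
  rw [h1, h2, Finsupp.tsub_apply, Finsupp.add_apply, Finsupp.single_eq_same, smul_eq_mul, smul_eq_mul, smul_eq_mul]
  have h := integral_gmz_div c (β j)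
  linear_combination (∏ k ∈ Finset.univ.erase j, ∫ t, gmz ((2 * π : ℂ) * z k) (β k) t) * h

/-- **Integration by parts in `ℝ^σ`**: `∫ (∂_j r − 4πx_j r + 2πz_j r)(x) e^{−2π|x|²+2πz·x} dx = 0` for every
polynomial `r` (the integrand is `∂_j (r e^{−2π|x|²+2πz·x})`). [folklore] -/
theorem gintz_div (z : σ → ℂ) (j : σ) (r : MvPolynomial σ ℂ) :
    gintz z (pderiv j r - (4 * π : ℂ) • (X j * r) + ((2 * π : ℂ) * z j) • r) = 0 := by
  induction r using MvPolynomial.induction_on' with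
  | monomial β a =>
      rw [monomial_eq_smul β a, Derivation.map_smul, mul_smul_comm, smul_comm (4 * π : ℂ) a,
        smul_comm ((2 * π : ℂ) * z j) a, ← smul_sub, ← smul_add, map_smul, gintz_div_monomial, smul_zero]
  | add p q hp hq =>
      rw [map_add, map_sub] at hp hq
      simp only [map_add, mul_add, smul_add, map_sub]
      linear_combination hp + hq

/-! ### The Bargmann kernel and the transform on the core `{p(x) e^{−π|x|²}}` -/

omit [DecidableEq σ] in
/-- `e^{2π x·z − π|x|²}`: Folland's kernel `e^{2πxz − πx² − (π/2)z²}`  without the factor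
`e^{−(π/2)z²}`, which does not depend on `x` and is kept outside the integral. [folklore] -/
def bkerCore (z : σ → ℂ) (x : σ → ℝ) : ℂ := cexp (∑ k, (-(π : ℂ) * (x k : ℂ) ^ 2 + (2 * π : ℂ) * z k * (x k : ℂ)))

omit [DecidableEq σ] in
/-- The Bargmann kernel core `x ↦ e^{Σ_k (−πx_k² + 2π z_k x_k)}` is continuous. [folklore] -/
theorem continuous_bkerCore (z : σ → ℂ) : Continuous (bkerCore z) := by
  unfold bkerCore
  fun_prop

omit [DecidableEq σ] in
/-- `e^{−π|x|²} · e^{−π|x|² + 2π z·x} = e^{−2π|x|² + 2π z·x}` (`gauss · bkerCore z = bweight z`).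
[folklore] -/
theorem gauss_mul_bkerCore (z : σ → ℂ) (x : σ → ℝ) : gauss x * bkerCore z x = bweight z x := by
  rw [gauss, bkerCore, bweight, ← Complex.exp_add, Finset.mul_sum, ← Finset.sum_add_distrib]
  congr 1
  exact Finset.sum_congr rfl fun k _ => by ring

omit [DecidableEq σ] in
/-- `(p(x) e^{−π|x|²}) · e^{−π|x|² + 2π z·x} = p(x) e^{−2π|x|² + 2π z·x}`. [folklore] -/
theorem hermiteFun_mul_bkerCore (p : MvPolynomial σ ℂ) (z : σ → ℂ) (x : σ → ℝ) :
    hermiteFun p x * bkerCore z x = eval (fun k => (x k : ℂ)) p * bweight z x := by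
  rw [hermiteFun, mul_assoc, gauss_mul_bkerCore]

omit [DecidableEq σ] in
/-- **The Bargmann transform as Folland's integral** :
`Bf(z) = 2^{n/4} ∫ f(x) e^{2πx·z − πx² − (π/2)z²} dx` (here `z² = Σ z_k²`, `x·z = Σ x_k z_k`; the constant factor
`e^{−(π/2)z²}` is written in front of the integral). [folklore] -/
def bargmannFun (f : (σ → ℝ) → ℂ) (z : σ → ℂ) : ℂ :=
  (vacCoef σ : ℂ) * cexp (-(π / 2 : ℂ) * ∑ k, z k ^ 2) * ∫ x : σ → ℝ, f x * bkerCore z x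

omit [DecidableEq σ] in
/-- On the Hermite core, Folland's integral is `2^{n/4} e^{−(π/2)Σ z_k²} · gintz z p`. [folklore] -/
theorem bargmannFun_hermiteFun (p : MvPolynomial σ ℂ) (z : σ → ℂ) :
    bargmannFun (hermiteFun p) z = (vacCoef σ : ℂ) * cexp (-(π / 2 : ℂ) * ∑ k, z k ^ 2) * gintz z p := by
  rw [bargmannFun, gintz_apply]
  simp_rw [hermiteFun_mul_bkerCore]

omit [DecidableEq σ] in
/-- `bargmannFun` only depends on the a.e. class of `f`. [folklore] -/
theorem bargmannFun_congr_ae {f g : (σ → ℝ) → ℂ} (h : f =ᵐ[volume] g) (z : σ → ℂ) :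
    bargmannFun f z = bargmannFun g z := by
  unfold bargmannFun
  congr 1
  exact integral_congr_ae (h.mono fun x hx => by
    show f x * bkerCore z x = g x * bkerCore z x
    rw [hx])

omit [DecidableEq σ] in
/-- `bargmannFun` in the PRINTED form (Folland), with `e^{−(π/2)z²}` inside the integral:
`Bf(z) = 2^{n/4} ∫ f(x) e^{2πx·z − πx² − (π/2)z²} dx`. [folklore] -/
theorem bargmannFun_eq_integral (f : (σ → ℝ) → ℂ) (z : σ → ℂ) :
    bargmannFun f z = (vacCoef σ : ℂ) *
      ∫ x : σ → ℝ, f x * cexp (∑ k, ((2 * π : ℂ) * (x k : ℂ) * z k - (π : ℂ) * (x k : ℂ) ^ 2) - (π / 2 : ℂ) * ∑ k, z k ^ 2) := by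
  rw [bargmannFun, mul_assoc, ← integral_const_mul]
  congr 1
  refine integral_congr_ae (Eventually.of_forall fun x => ?_)
  have hs : ∑ k, ((2 * π : ℂ) * (x k : ℂ) * z k - (π : ℂ) * (x k : ℂ) ^ 2) - (π / 2 : ℂ) * ∑ k, z k ^ 2 =
      ∑ k, (-(π : ℂ) * (x k : ℂ) ^ 2 + (2 * π : ℂ) * z k * (x k : ℂ)) + -(π / 2 : ℂ) * ∑ k, z k ^ 2 := by
    rw [Finset.sum_congr rfl fun k _ =>
      show (2 * π : ℂ) * (x k : ℂ) * z k - (π : ℂ) * (x k : ℂ) ^ 2 = -(π : ℂ) * (x k : ℂ) ^ 2 + (2 * π : ℂ) * z k * (x k : ℂ)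
      by ring]
    ring
  show cexp (-(π / 2 : ℂ) * ∑ k, z k ^ 2) * (f x * bkerCore z x) = f x * cexp _
  rw [hs, Complex.exp_add, bkerCore]
  ring

/-- **`B(Z_j^* g) = z_j · Bg`** on the core (Folland (1.73)/(1.75): `A_j^* = √π B(X_j − iD_j)B⁻¹ = √π z_j`, by
integration by parts). [cite: Folland1989, (1.75)] -/
theorem bargmannFun_opZs (j : σ) (p : MvPolynomial σ ℂ) (z : σ → ℂ) :
    bargmannFun (hermiteFun (opZs j p)) z = z j * bargmannFun (hermiteFun p) z := by
  rw [bargmannFun_hermiteFun, bargmannFun_hermiteFun, opZs_apply, map_sub, map_smul, map_smul]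
  have h := gintz_div z j p
  rw [map_add, map_sub, map_smul, map_smul, smul_eq_mul, smul_eq_mul] at h
  have hP : gintz z (pderiv j p) = (4 * π : ℂ) * gintz z (X j * p) - (2 * π : ℂ) * z j * gintz z p := by
    linear_combination h
  rw [hP, smul_eq_mul, smul_eq_mul]
  have hπ : (2 * π : ℂ) ≠ 0 := two_pi_ne_zero
  field_simp
  ring

omit [DecidableEq σ] in
/-- **`B h_0 = 1`** (Folland (1.72) at `w = 0`: `B φ_0 = E_0 = 1`; the Gaussian integral
`2^{n/4} ∫ 2^{n/4}e^{−πx²} e^{2πxz−πx²−(π/2)z²} dx = 1`). [cite: Folland1989, (1.72)] -/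
theorem bargmannFun_vac (z : σ → ℂ) : bargmannFun (hermiteFun (vac σ)) z = 1 := by
  rw [bargmannFun_hermiteFun, vac, show (C (vacCoef σ : ℂ) : MvPolynomial σ ℂ) = (vacCoef σ : ℂ) • monomial 0 1 by
    rw [← monomial_eq_smul]; rfl, map_smul, gintz_monomial]
  simp_rw [Finsupp.coe_zero, Pi.zero_apply, integral_gmz_zero]
  rw [Finset.prod_mul_distrib, Finset.prod_const, Finset.card_univ, ← Complex.exp_sum, smul_eq_mul]
  have hsum : ∑ k, ((2 * π : ℂ) * z k) ^ 2 / (8 * π) = (π / 2 : ℂ) * ∑ k, z k ^ 2 := by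
    rw [Finset.mul_sum]
    refine Finset.sum_congr rfl fun k _ => ?_
    have hπ : (π : ℂ) ≠ 0 := (Complex.ofReal_ne_zero.mpr Real.pi_ne_zero)
    field_simp
    ring
  rw [hsum]
  have hexp : cexp (-(π / 2 : ℂ) * ∑ k, z k ^ 2) * cexp ((π / 2 : ℂ) * ∑ k, z k ^ 2) = 1 := by
    rw [← Complex.exp_add, show -(π / 2 : ℂ) * ∑ k, z k ^ 2 + (π / 2 : ℂ) * ∑ k, z k ^ 2 = 0 by ring, Complex.exp_zero]
  have hconst : (vacCoef σ : ℝ) * ((vacCoef σ : ℝ) * ((Real.sqrt 2)⁻¹) ^ Fintype.card σ) = 1 := by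
    rw [vacCoef, ← mul_assoc, ← Real.rpow_add two_pos, Real.sqrt_eq_rpow, ← Real.rpow_neg_one, ← Real.rpow_mul (by norm_num),
      ← Real.rpow_natCast, ← Real.rpow_mul (by norm_num), ← Real.rpow_add two_pos]
    rw [show (Fintype.card σ : ℝ) / 4 + (Fintype.card σ : ℝ) / 4 + 1 / 2 * -1 * (Fintype.card σ : ℝ) = 0 by ring,
      Real.rpow_zero]
  calc (vacCoef σ : ℂ) * cexp (-(π / 2 : ℂ) * ∑ k, z k ^ 2) *
        ((vacCoef σ : ℂ) * ((((Real.sqrt 2)⁻¹ : ℝ) : ℂ) ^ Fintype.card σ * cexp ((π / 2 : ℂ) * ∑ k, z k ^ 2)))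
      = (((vacCoef σ : ℝ) * ((vacCoef σ : ℝ) * ((Real.sqrt 2)⁻¹) ^ Fintype.card σ) : ℝ) : ℂ) *
          (cexp (-(π / 2 : ℂ) * ∑ k, z k ^ 2) * cexp ((π / 2 : ℂ) * ∑ k, z k ^ 2)) := by push_cast; ring
    _ = 1 := by rw [hconst, hexp]; simp

/-- **`B(F(Z^*) h_0)(z) = F(z)`** for every polynomial `F` (Folland (1.78) read through `B`): induction over `F`
using `B h_0 = 1` and `B Z_j^* = z_j B`. [cite: Folland1989, (1.78)] -/
theorem bargmannFun_binv (F : MvPolynomial σ ℂ) (z : σ → ℂ) :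
    bargmannFun (hermiteFun (binv F)) z = eval z F := by
  induction F using MvPolynomial.induction_on with
  | C a =>
      rw [binv_C, bargmannFun_hermiteFun, map_smul, smul_eq_mul, eval_C]
      have h := bargmannFun_vac (σ := σ) z
      rw [bargmannFun_hermiteFun] at h
      linear_combination a * h
  | add F G hF hG =>
      rw [map_add, bargmannFun_hermiteFun, map_add, mul_add, ← bargmannFun_hermiteFun, ← bargmannFun_hermiteFun, hF, hG,
        map_add]
  | mul_X F j hF =>
      rw [mul_comm, binv_X_mul, bargmannFun_opZs, hF, map_mul, eval_X, mul_comm]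

/-- The `L²(ℂ^σ)`-avatar identity on the core: `F(z) e^{−(π/2)|z|²} = e^{−(π/2)|z|²} · B(F(Z^*)h_0)(z)`.
[folklore] -/
theorem fockFun_eq_bargmannFun (F : MvPolynomial σ ℂ) (z : σ → ℂ) :
    fockFun F z = ((fockWeight z : ℝ) : ℂ) * bargmannFun (hermiteFun (binv F)) z := by
  rw [bargmannFun_binv, fockFun, mul_comm]

end NDim

/-! ### Extension from the core to all of `L²(ℝ^σ)` -/

section L2

variable {σ : Type*} [Fintype σ] [DecidableEq σ]

omit [DecidableEq σ] in
/-- Real part of the kernel exponent: `Re Σ_k (−πx_k² + 2π z_k x_k) = −π|x|² + Σ_k 2π (Re z_k)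
x_k`. [folklore] -/
theorem re_bkerExponent (z : σ → ℂ) (x : σ → ℝ) :
    (∑ k, (-(π : ℂ) * (x k : ℂ) ^ 2 + (2 * π : ℂ) * z k * (x k : ℂ))).re =
      -π * ∑ k, x k ^ 2 + ∑ k, 2 * π * (z k).re * x k := by
  rw [Complex.re_sum, Finset.mul_sum, ← Finset.sum_add_distrib]
  refine Finset.sum_congr rfl fun k _ => ?_
  have e1 : (-(π : ℂ) * (x k : ℂ) ^ 2).re = -π * x k ^ 2 := by
    rw [← Complex.ofReal_pow, ← Complex.ofReal_neg, ← Complex.ofReal_mul, Complex.ofReal_re]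
  have e2 : ((2 * π : ℂ) * z k * (x k : ℂ)).re = 2 * π * (z k).re * x k := by
    rw [Complex.mul_re, Complex.ofReal_re, Complex.ofReal_im, mul_zero, sub_zero, Complex.mul_re,
      show (2 * π : ℂ) = ((2 * π : ℝ) : ℂ) by push_cast; rfl, Complex.ofReal_re, Complex.ofReal_im, zero_mul, sub_zero]
  rw [Complex.add_re, e1, e2]

omit [DecidableEq σ] in
/-- `|e^{2πx·z − π|x|²}| = e^{−π|x|² + 2π x·Re z}`. [folklore] -/
theorem norm_bkerCore (z : σ → ℂ) (x : σ → ℝ) :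
    ‖bkerCore z x‖ = Real.exp (-π * ∑ k, x k ^ 2 + ∑ k, 2 * π * (z k).re * x k) := by
  rw [bkerCore, Complex.norm_exp, re_bkerExponent]

omit [DecidableEq σ] in
/-- For fixed `z`, the kernel `x ↦ e^{2πx·z − π|x|²}` is square integrable. [folklore] -/
theorem memLp_bkerCore (z : σ → ℂ) : MemLp (bkerCore z) 2 (volume : Measure (σ → ℝ)) :=
  (memLp_two_exp_quadratic (fun k => 2 * π * (z k).re)).of_le (continuous_bkerCore z).aestronglyMeasurable
    (Eventually.of_forall fun x => by
      rw [norm_bkerCore, Real.norm_eq_abs, abs_of_pos (Real.exp_pos _)])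

omit [DecidableEq σ] in
/-- The conjugated kernel core `x ↦ conj (e^{−π|x|² + 2π z·x})` is in `L²(ℝ^σ)`. [folklore] -/
theorem memLp_conj_bkerCore (z : σ → ℂ) :
    MemLp (fun x => starRingEnd ℂ (bkerCore z x)) 2 (volume : Measure (σ → ℝ)) :=
  (memLp_bkerCore z).of_le (Complex.continuous_conj.comp (continuous_bkerCore z)).aestronglyMeasurable
    (Eventually.of_forall fun x => by rw [Complex.norm_conj])

omit [DecidableEq σ] in
/-- The conjugate kernel as an element of `L²(ℝ^σ)`. [folklore] -/
def bkerL2 (z : σ → ℂ) : Lp ℂ 2 (volume : Measure (σ → ℝ)) := (memLp_conj_bkerCore z).toLp _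

omit [DecidableEq σ] in
/-- `bkerL2 z` is represented by `x ↦ conj (bkerCore z x)` (a.e.). [folklore] -/
theorem bkerL2_coeFn (z : σ → ℂ) : ⇑(bkerL2 z) =ᵐ[volume] fun x => starRingEnd ℂ (bkerCore z x) :=
  MemLp.coeFn_toLp _

omit [DecidableEq σ] in
/-- `∫ f(x) e^{2πx·z−π|x|²} dx = ⟨K_z, f⟩_{L²}`: for fixed `z`, `f ↦ Bf(z)` is a bounded functional on `L²(ℝ^σ)`.
[folklore] -/
theorem integral_mul_bkerCore_eq_inner (f : Lp ℂ 2 (volume : Measure (σ → ℝ))) (z : σ → ℂ) :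
    ∫ x, f x * bkerCore z x = ⟪bkerL2 z, f⟫_ℂ := by
  rw [MeasureTheory.L2.inner_def]
  refine integral_congr_ae ?_
  filter_upwards [bkerL2_coeFn z] with x hx
  rw [RCLike.inner_apply, hx, Complex.conj_conj]

omit [DecidableEq σ] in
/-- `Bf(z) = 2^{n/4} e^{−(π/2)Σ z_k²} · ⟨K_z, f⟩_{L²}` — Folland's integral as an inner product
against the `L²` kernel `K_z = bkerL2 z`. [folklore] -/
theorem bargmannFun_eq_inner (f : Lp ℂ 2 (volume : Measure (σ → ℝ))) (z : σ → ℂ) :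
    bargmannFun f z = (vacCoef σ : ℂ) * cexp (-(π / 2 : ℂ) * ∑ k, z k ^ 2) * ⟪bkerL2 z, f⟫_ℂ := by
  rw [bargmannFun, integral_mul_bkerCore_eq_inner]

omit [DecidableEq σ] in
/-- For fixed `z`, `f ↦ Bf(z)` is continuous on `L²(ℝ^σ)`. [folklore] -/
theorem continuous_bargmannFun (z : σ → ℂ) :
    Continuous fun f : Lp ℂ 2 (volume : Measure (σ → ℝ)) => bargmannFun f z := by
  have h : (fun f : Lp ℂ 2 (volume : Measure (σ → ℝ)) => bargmannFun f z) =
      fun f => (vacCoef σ : ℂ) * cexp (-(π / 2 : ℂ) * ∑ k, z k ^ 2) * ⟪bkerL2 z, f⟫_ℂ :=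
    funext fun f => bargmannFun_eq_inner f z
  rw [h]
  exact continuous_const.mul (continuous_const.inner continuous_id)

/-- On the core: the unitary `bargmann` IS Folland's integral transform (times the transport weight).
[folklore] -/
theorem bargmann_hermToL2_coeFn (p : MvPolynomial σ ℂ) :
    ⇑(((bargmann (hermToL2 p) : FockL2 σ)) : Lp ℂ 2 (volume : Measure (σ → ℂ))) =ᵐ[volume]
      fun z => ((fockWeight z : ℝ) : ℂ) * bargmannFun (hermToL2 p) z := by
  obtain ⟨F, rfl⟩ := binv_surjective p
  rw [bargmann_hermToL2_binv]
  filter_upwards [fockToL2_coeFn F] with z hz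
  rw [hz, fockFun_eq_bargmannFun, bargmannFun_congr_ae (hermToL2_coeFn (binv F)) z]

/-- **The Bargmann transform formula on all of `L²(ℝ^σ)`** (Folland §1.6: the definition of `Bf` and
`B(L²(ℝⁿ)) = 𝓕_n` after (1.72)):
for EVERY `f ∈ L²(ℝ^σ)`, the unitary `bargmann` (defined by `h_α ↦ ζ_α`) is represented a.e. by Folland's integral:
`(bargmann f)(z) = e^{−(π/2)|z|²} · 2^{n/4} ∫ f(x) e^{2πx·z − πx² − (π/2)z²} dx`. [cite: Folland1989, §1.6] -/
theorem bargmann_coeFn (f : Lp ℂ 2 (volume : Measure (σ → ℝ))) :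
    ⇑(((bargmann f : FockL2 σ)) : Lp ℂ 2 (volume : Measure (σ → ℂ))) =ᵐ[volume]
      fun z => ((fockWeight z : ℝ) : ℂ) * bargmannFun f z := by
  -- the transported unitary, as a continuous map into `L²(ℂ^σ)`
  set T : Lp ℂ 2 (volume : Measure (σ → ℝ)) → Lp ℂ 2 (volume : Measure (σ → ℂ)) :=
    fun g => ((bargmann g : FockL2 σ) : Lp ℂ 2 (volume : Measure (σ → ℂ))) with hT_def
  have hT : Continuous T := continuous_subtype_val.comp bargmann.continuous
  -- a sequence of core functions `p_n e^{−π|x|²}` converging to `f` in `L²`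
  have hmem : f ∈ closure ((LinearMap.range (hermToL2 (σ := σ)) : Set (Lp ℂ 2 (volume : Measure (σ → ℝ))))) := by
    rw [← Submodule.topologicalClosure_coe, hermToL2_denseRange]
    trivial
  obtain ⟨u, hu_mem, hu_tend⟩ := mem_closure_iff_seq_limit.mp hmem
  have h1 : Tendsto (fun n => T (u n)) atTop (𝓝 (T f)) := (hT.tendsto f).comp hu_tend
  -- an a.e.-convergent subsequence
  obtain ⟨ns, hns, hlim⟩ := (tendstoInMeasure_of_tendsto_Lp h1).exists_seq_tendsto_ae
  have h3 : ∀ n, ⇑(T (u n)) =ᵐ[volume] fun z => ((fockWeight z : ℝ) : ℂ) * bargmannFun (u n) z := fun n => by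
    obtain ⟨p, hp⟩ := LinearMap.mem_range.mp (hu_mem n)
    rw [← hp]
    exact bargmann_hermToL2_coeFn p
  have h4 : ∀ᵐ z ∂(volume : Measure (σ → ℂ)), ∀ n, (T (u n)) z = ((fockWeight z : ℝ) : ℂ) * bargmannFun (u n) z :=
    ae_all_iff.mpr h3
  filter_upwards [hlim, h4] with z hzlim hz4
  have h5 : Tendsto (fun i => ((fockWeight z : ℝ) : ℂ) * bargmannFun (u (ns i)) z) atTop
      (𝓝 (((fockWeight z : ℝ) : ℂ) * bargmannFun f z)) := by
    have hc : Continuous fun g : Lp ℂ 2 (volume : Measure (σ → ℝ)) => ((fockWeight z : ℝ) : ℂ) * bargmannFun g z :=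
      continuous_const.mul (continuous_bargmannFun z)
    exact (hc.tendsto f).comp (hu_tend.comp hns.tendsto_atTop)
  have h6 : (fun i => (T (u (ns i))) z) = fun i => ((fockWeight z : ℝ) : ℂ) * bargmannFun (u (ns i)) z :=
    funext fun i => hz4 (ns i)
  rw [h6] at hzlim
  exact tendsto_nhds_unique hzlim h5

end L2

end

end Literature.Analysis.SegalBargmann
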